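import Summits.AtomisticToContinuum.HydrodynamicLimit.Theses.JParityClosure
import Literature.MathematicalPhysics.KineticTheory.HardSphereEulerProofs
import Literature.MathematicalPhysics.KineticTheory.HardSphereUniformGas
import Summits.AtomisticToContinuum.HydrodynamicLimit.Theorems.JParityClosureOddContactSymmetryFixedBallVoidLevel
import HarnessLib

/-!
# Fixed-ball void estimate for the dilute canonical hard-sphere gas (V1 of P4)

Crux `JParityClosure.OddContactSymmetry` (stmt-AtomisticToContinuum-17722), line `KineticSlabSketch`,
registered stub `stub_fixedBallVoid`: under the configurational canonical Gibbs measure of `N + 1`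
hard spheres of diameter `ε = σ (N+1)^{-1/3}` on `𝕋³` (unit activity, `σ ≤ σ₀ = 1/2`), a fixed ball of
radius `R ∈ [512 ε, 1/4]` contains at most `(N+1) R³ / 64` centres with probability `≤ y` as soon as
`(N+1) R³ ≥ n₀(y)`, uniformly in `N`, `R` and the centre.

Proof.  By the one-step level comparison of the companion file
(`posGibbs_occLevel_step`: `2 P(occ = m) ≤ P(occ = m+1)` once `w + m|B_ε| ≤ vol B(c, R − ε)` and
`2(m+1) ≤ (N+1−m) w`), applied with the explicit free-volume bound `w = (4π/3)((R − ε)³ − 2Tε³)`,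
`T = ⌊(N+1)R³/64⌋`, valid at every level `m ≤ 2T` (`levelStep_arith`: `(R−ε)³ ≥ R³/8`,
`2Tε³ ≤ σ³R³/32 ≤ R³/256`, `m ≤ (N+1)/2048`, `(N+1)R³ ≥ 64`), the level probabilities double
`T + 1` times from each level `m ≤ T` (`posGibbs_occLevel_le_inv_two_pow`), so
`P(occ ≤ (N+1)R³/64) = Σ_{m ≤ T} P(occ = m) ≤ (T + 1) 2^{-(T+1)} ≤ y` for `T ≥ T₀(y)`, i.e. for
`(N+1) R³ ≥ n₀ = 64 (T₀ + 1)`.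
-/

noncomputable section

open scoped BigOperators Classical InnerProductSpace ENNReal Topology
open Set MeasureTheory Filter
open Literature.Analysis.FluidPDE Literature.MathematicalPhysics.KineticTheory

namespace Summit.AtomisticToContinuum.HydrodynamicLimit.Theorems.OddContactSymmetryKineticSlab

/-! ### Iterating the level comparison -/

/-- **Iterating the level comparison.** If `2 P(occ = m) ≤ P(occ = m + 1)` for all `m ≤ M₀`, then
`P(occ = m) ≤ 2^{-K}` whenever `m + K ≤ M₀ + 1` (probability measure). [folklore] -/
theorem posGibbs_occLevel_le_inv_two_pow {n : ℕ} (μ : Measure (Fin n → T3)) [IsProbabilityMeasure μ]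
    (c : T3) (R : ℝ) {M₀ : ℕ}
    (hstep : ∀ m, m ≤ M₀ → 2 * μ {x : Fin n → T3 |
        (Finset.univ.filter fun k : Fin n => Torus.euclidDist (x k) c < R).card = m} ≤
      μ {x : Fin n → T3 | (Finset.univ.filter fun k : Fin n => Torus.euclidDist (x k) c < R).card = m + 1})
    {K m : ℕ} (hKm : m + K ≤ M₀ + 1) :
    μ {x : Fin n → T3 | (Finset.univ.filter fun k : Fin n => Torus.euclidDist (x k) c < R).card = m} ≤
      (2⁻¹ : ℝ≥0∞) ^ K := by
  have hind : ∀ K m, m + K ≤ M₀ + 1 → (2 : ℝ≥0∞) ^ K * μ {x : Fin n → T3 |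
        (Finset.univ.filter fun k : Fin n => Torus.euclidDist (x k) c < R).card = m} ≤
      μ {x : Fin n → T3 | (Finset.univ.filter fun k : Fin n => Torus.euclidDist (x k) c < R).card = m + K} := by
    intro K
    induction K with
    | zero => intro m _; simp
    | succ K ih =>
        intro m hm
        calc (2 : ℝ≥0∞) ^ (K + 1) * μ {x : Fin n → T3 |
              (Finset.univ.filter fun k : Fin n => Torus.euclidDist (x k) c < R).card = m}
            = 2 ^ K * (2 * μ {x : Fin n → T3 |
              (Finset.univ.filter fun k : Fin n => Torus.euclidDist (x k) c < R).card = m}) := by ring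
          _ ≤ 2 ^ K * μ {x : Fin n → T3 |
              (Finset.univ.filter fun k : Fin n => Torus.euclidDist (x k) c < R).card = m + 1} :=
            mul_le_mul' le_rfl (hstep m (by omega))
          _ ≤ μ {x : Fin n → T3 |
              (Finset.univ.filter fun k : Fin n => Torus.euclidDist (x k) c < R).card = m + 1 + K} :=
            ih (m + 1) (by omega)
          _ = _ := by rw [show m + 1 + K = m + (K + 1) by omega]
  have h := (hind K m hKm).trans prob_le_one
  rw [← ENNReal.inv_pow, ENNReal.le_inv_iff_mul_le, mul_comm]
  exact h

/-! ### Arithmetic of the constants and the registered stub -/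

/-- **Arithmetic of the level comparison.** With `512 ε ≤ R ≤ 1/4`, `n ε³ ≤ 1/8`, `T ≤ n R³ / 64`,
`m ≤ 2T` and `n R³ ≥ 64`: the free-volume lower bound `w = (4π/3)((R − ε)³ − 2T ε³)` is nonnegative,
`m + 1 ≤ n`, and `2 (m + 1) ≤ (n − m) w`. [folklore] -/
theorem levelStep_arith {n R ε T m : ℝ} (hn : 0 ≤ n) (hε0 : 0 < ε) (hR : 512 * ε ≤ R)
    (hR4 : R ≤ 1 / 4) (hnε : n * ε ^ 3 ≤ 1 / 8) (hT : T ≤ n * R ^ 3 / 64) (hm : m ≤ 2 * T)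
    (ht : 64 ≤ n * R ^ 3) :
    0 ≤ Real.pi * 4 / 3 * ((R - ε) ^ 3 - 2 * T * ε ^ 3) ∧ m + 1 ≤ n ∧
      2 * (m + 1) ≤ (n - m) * (Real.pi * 4 / 3 * ((R - ε) ^ 3 - 2 * T * ε ^ 3)) := by
  have hR0 : 0 < R := by linarith
  have hR3 : R ^ 3 ≤ 1 / 64 := by
    have h := pow_le_pow_left₀ hR0.le hR4 3
    linarith [show ((1 : ℝ) / 4) ^ 3 = 1 / 64 by norm_num]
  -- `(R - ε)³ ≥ R³ / 8`
  have hcube : R ^ 3 / 8 ≤ (R - ε) ^ 3 := by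
    have h := pow_le_pow_left₀ (by positivity : (0 : ℝ) ≤ R / 2) (by linarith : R / 2 ≤ R - ε) 3
    linarith [show (R / 2) ^ 3 = R ^ 3 / 8 by ring]
  -- `2 T ε³ ≤ R³ / 256`
  have hTε : 2 * T * ε ^ 3 ≤ R ^ 3 / 256 := by
    have hε3 : 0 ≤ ε ^ 3 := by positivity
    calc 2 * T * ε ^ 3 ≤ 2 * (n * R ^ 3 / 64) * ε ^ 3 := by gcongr
      _ = R ^ 3 * (n * ε ^ 3) / 32 := by ring
      _ ≤ R ^ 3 * (1 / 8) / 32 := by gcongr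
      _ = R ^ 3 / 256 := by ring
  have hbr : 31 * R ^ 3 / 256 ≤ (R - ε) ^ 3 - 2 * T * ε ^ 3 := by linarith
  have hP : (4 : ℝ) ≤ Real.pi * 4 / 3 := by linarith [Real.pi_gt_three]
  have hR30 : 0 ≤ R ^ 3 := by positivity
  have hw : 31 * R ^ 3 / 64 ≤ Real.pi * 4 / 3 * ((R - ε) ^ 3 - 2 * T * ε ^ 3) := by
    calc 31 * R ^ 3 / 64 = 4 * (31 * R ^ 3 / 256) := by ring
      _ ≤ Real.pi * 4 / 3 * ((R - ε) ^ 3 - 2 * T * ε ^ 3) :=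
        mul_le_mul hP hbr (by positivity) (by positivity)
  -- `m ≤ 2 T ≤ n R³ / 32 ≤ n / 2048`
  have hnR : n * R ^ 3 ≤ n * (1 / 64) := mul_le_mul_of_nonneg_left hR3 hn
  have hm' : m ≤ n * R ^ 3 / 32 := by linarith
  have hnm : n / 2 ≤ n - m := by linarith
  have hprod : n / 2 * (31 * R ^ 3 / 64) ≤
      (n - m) * (Real.pi * 4 / 3 * ((R - ε) ^ 3 - 2 * T * ε ^ 3)) :=
    mul_le_mul hnm hw (by positivity) (by linarith)
  refine ⟨by linarith, by linarith, ?_⟩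
  linarith

/-- **Registered stub `stub_fixedBallVoid` (V1 of P4, line `KineticSlabSketch` of crux
`JParityClosure.OddContactSymmetry`).** Fixed-ball void estimate for the dilute canonical hard-sphere
gas on `𝕋³` (`σ₀ = 1/2`): the probability that the ball `B(c, R)`, `512 ε ≤ R ≤ 1/4`, holds at most
`(N+1)R³/64` of the `N + 1` centres is `≤ y` once `(N+1) R³ ≥ n₀(y)` — level comparison
`P(occ = m) ≤ P(occ = m+1)/2` for `m ≤ (N+1)R³/32` (`posGibbs_occLevel_step`, `levelStep_arith`),
iterated (`posGibbs_occLevel_le_inv_two_pow`) and summed over the levels `m ≤ ⌊(N+1)R³/64⌋`.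
[folklore] -/
theorem stub_fixedBallVoid :
    ∃ σ₀ : ℝ, 0 < σ₀ ∧ ∀ {σ : ℝ} (_hσ : 0 < σ) (_hσ0 : σ ≤ σ₀) (y : ℝ) (_hy : 0 < y),
    ∃ n₀ : ℝ, ∀ {N : ℕ} {R : ℝ} (_hR : 512 * hsDiameter σ N ≤ R) (_hR4 : R ≤ 1 / 4)
      (_hn : n₀ ≤ ((N : ℝ) + 1) * R ^ 3) (c : UnitAddTorus (Fin 3)),
      posGibbsMeasure (fun _ : T3 => (1 : ℝ)) (hsDiameter σ N) (N + 1)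
          {x | ((Finset.univ.filter fun k : Fin (N + 1) => Torus.euclidDist (x k) c < R).card : ℝ) ≤
            ((N : ℝ) + 1) * R ^ 3 / 64} ≤ ENNReal.ofReal y := by
  refine ⟨1 / 2, by norm_num, ?_⟩
  intro σ hσ hσ2 y hy
  -- geometric decay of `(T + 1) 2^{-(T + 1)}`
  obtain ⟨T₀, hT₀⟩ : ∃ T₀ : ℕ, ∀ T : ℕ, T₀ ≤ T → ((T : ℝ) + 1) * (2⁻¹ : ℝ) ^ (T + 1) ≤ y := by
    have h := (tendsto_self_mul_const_pow_of_lt_one (r := (2⁻¹ : ℝ)) (by norm_num)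
      (by norm_num)).comp (tendsto_add_atTop_nat 1)
    obtain ⟨T₀, hT₀⟩ := eventually_atTop.1 (h.eventually (Iic_mem_nhds hy))
    refine ⟨T₀, fun T hT => ?_⟩
    have h1 := hT₀ T hT
    simp only [Function.comp_apply, Nat.cast_add, Nat.cast_one] at h1
    exact h1
  refine ⟨64 * ((T₀ : ℝ) + 1), ?_⟩
  intro N R hR hR4 hn c
  set ε := hsDiameter σ N with hεdef
  set T : ℕ := ⌊((N : ℝ) + 1) * R ^ 3 / 64⌋₊ with hTdef
  set μ := posGibbsMeasure (fun _ : T3 => (1 : ℝ)) ε (N + 1) with hμ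
  haveI : IsProbabilityMeasure μ :=
    isProbabilityMeasure_posGibbsMeasure continuous_const (fun _ => one_pos) hσ2 N
  have hε0 : 0 < ε := hsDiameter_pos hσ N
  have hε2 : ε < 1 / 2 := by linarith
  have hRε2 : R - ε < 1 / 2 := by linarith
  have hRε0 : 0 ≤ R - ε := by linarith
  have ht64 : 64 ≤ ((N : ℝ) + 1) * R ^ 3 := by
    have h0 : (0 : ℝ) ≤ T₀ := Nat.cast_nonneg T₀
    linarith
  have hTT₀ : T₀ ≤ T := by
    have h1 : ((T₀ + 1 : ℕ) : ℝ) ≤ ((N : ℝ) + 1) * R ^ 3 / 64 := by push_cast; linarith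
    have h2 := Nat.le_floor h1
    omega
  have hnε : ((N : ℝ) + 1) * ε ^ 3 ≤ 1 / 8 := by
    have h := succ_mul_hsDiameter_pow_three σ N
    push_cast at h
    rw [h]
    have h3 := pow_le_pow_left₀ hσ.le hσ2 3
    linarith [show ((1 : ℝ) / 2) ^ 3 = 1 / 8 by norm_num]
  have hT : (T : ℝ) ≤ ((N : ℝ) + 1) * R ^ 3 / 64 := Nat.floor_le (by positivity)
  have hball : volume (Metric.ball (0 : V3) ε) = ENNReal.ofReal (ε ^ 3 * (Real.pi * 4 / 3)) := by
    rw [EuclideanSpace.volume_ball_fin_three, ← ENNReal.ofReal_pow hε0.le,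
      ← ENNReal.ofReal_mul (pow_nonneg hε0.le 3)]
  have hin : volume {q : T3 | Torus.euclidDist q c < R - ε} =
      ENNReal.ofReal ((R - ε) ^ 3 * (Real.pi * 4 / 3)) := by
    rw [Torus.volume_euclidDist_lt hRε2, EuclideanSpace.volume_ball_fin_three,
      ← ENNReal.ofReal_pow hRε0, ← ENNReal.ofReal_mul (pow_nonneg hRε0 3)]
  -- the one-step comparison at all levels `m ≤ 2T`
  have hstep : ∀ m : ℕ, m ≤ 2 * T →
      2 * μ {x : Fin (N + 1) → T3 |
          (Finset.univ.filter fun k : Fin (N + 1) => Torus.euclidDist (x k) c < R).card = m} ≤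
        μ {x : Fin (N + 1) → T3 |
          (Finset.univ.filter fun k : Fin (N + 1) => Torus.euclidDist (x k) c < R).card = m + 1} := by
    intro m hm
    have hm' : (m : ℝ) ≤ 2 * (T : ℝ) := by exact_mod_cast hm
    obtain ⟨hw0, hmn, h2⟩ := levelStep_arith (by positivity) hε0 hR hR4 hnε hT hm' ht64
    have hmN : m ≤ N + 1 := by
      have h1 : ((m + 1 : ℕ) : ℝ) ≤ ((N + 1 : ℕ) : ℝ) := by push_cast; exact hmn
      have h2 : m + 1 ≤ N + 1 := by exact_mod_cast h1
      omega
    refine posGibbs_occLevel_step (n := N + 1) hε0.le hε2 c m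
      (w := ENNReal.ofReal (Real.pi * 4 / 3 * ((R - ε) ^ 3 - 2 * T * ε ^ 3))) ?_ ?_
    · have e : ENNReal.ofReal (Real.pi * 4 / 3 * ((R - ε) ^ 3 - 2 * T * ε ^ 3) +
          m * (ε ^ 3 * (Real.pi * 4 / 3))) =
          ENNReal.ofReal (Real.pi * 4 / 3 * ((R - ε) ^ 3 - 2 * T * ε ^ 3)) +
            m * volume (Metric.ball (0 : V3) ε) := by
        rw [ENNReal.ofReal_add hw0 (by positivity), ENNReal.ofReal_mul (Nat.cast_nonneg m),
          ENNReal.ofReal_natCast, hball]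
      rw [← e, hin]
      refine ENNReal.ofReal_le_ofReal ?_
      have hpos : 0 ≤ Real.pi * 4 / 3 * ε ^ 3 * (2 * T - m) :=
        mul_nonneg (by positivity) (by linarith)
      linarith
    · have e1 : ENNReal.ofReal (2 * ((m : ℝ) + 1)) = 2 * ((m : ℝ≥0∞) + 1) := by
        rw [ENNReal.ofReal_mul zero_le_two, ENNReal.ofReal_ofNat,
          ENNReal.ofReal_add (Nat.cast_nonneg m) zero_le_one, ENNReal.ofReal_natCast,
          ENNReal.ofReal_one]
      have e2 : ENNReal.ofReal ((((N : ℝ) + 1) - m) *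
          (Real.pi * 4 / 3 * ((R - ε) ^ 3 - 2 * T * ε ^ 3))) =
          ((N + 1 - m : ℕ) : ℝ≥0∞) *
            ENNReal.ofReal (Real.pi * 4 / 3 * ((R - ε) ^ 3 - 2 * T * ε ^ 3)) := by
        rw [ENNReal.ofReal_mul (by linarith), ← ENNReal.ofReal_natCast (N + 1 - m), Nat.cast_sub hmN]
        push_cast
        rfl
      rw [← e1, ← e2]
      exact ENNReal.ofReal_le_ofReal h2
  -- iterate `T + 1` times from each level `m ≤ T` and sum
  have hlev : ∀ m ∈ Finset.range (T + 1),
      μ {x : Fin (N + 1) → T3 |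
        (Finset.univ.filter fun k : Fin (N + 1) => Torus.euclidDist (x k) c < R).card = m} ≤
        (2⁻¹ : ℝ≥0∞) ^ (T + 1) := fun m hm =>
    posGibbs_occLevel_le_inv_two_pow μ c R (M₀ := 2 * T) hstep
      (by have h := Finset.mem_range.1 hm; omega)
  have hsub : {x : Fin (N + 1) → T3 |
      ((Finset.univ.filter fun k : Fin (N + 1) => Torus.euclidDist (x k) c < R).card : ℝ) ≤
        ((N : ℝ) + 1) * R ^ 3 / 64} ⊆
      ⋃ m ∈ Finset.range (T + 1), {x : Fin (N + 1) → T3 |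
        (Finset.univ.filter fun k : Fin (N + 1) => Torus.euclidDist (x k) c < R).card = m} := by
    intro x hx
    have hx' : (((Finset.univ.filter fun k : Fin (N + 1) => Torus.euclidDist (x k) c < R).card : ℕ) : ℝ) ≤
        ((N : ℝ) + 1) * R ^ 3 / 64 := hx
    exact mem_biUnion (Finset.mem_range.2 (Nat.lt_succ_of_le (Nat.le_floor hx'))) rfl
  calc μ {x : Fin (N + 1) → T3 |
        ((Finset.univ.filter fun k : Fin (N + 1) => Torus.euclidDist (x k) c < R).card : ℝ) ≤
          ((N : ℝ) + 1) * R ^ 3 / 64}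
      ≤ μ (⋃ m ∈ Finset.range (T + 1), {x : Fin (N + 1) → T3 |
          (Finset.univ.filter fun k : Fin (N + 1) => Torus.euclidDist (x k) c < R).card = m}) :=
        measure_mono hsub
    _ ≤ ∑ m ∈ Finset.range (T + 1), μ {x : Fin (N + 1) → T3 |
          (Finset.univ.filter fun k : Fin (N + 1) => Torus.euclidDist (x k) c < R).card = m} :=
        measure_biUnion_finset_le _ _
    _ ≤ ∑ _m ∈ Finset.range (T + 1), (2⁻¹ : ℝ≥0∞) ^ (T + 1) := Finset.sum_le_sum hlev
    _ = ((T + 1 : ℕ) : ℝ≥0∞) * (2⁻¹ : ℝ≥0∞) ^ (T + 1) := by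
        rw [Finset.sum_const, Finset.card_range, nsmul_eq_mul]
    _ = ENNReal.ofReal (((T : ℝ) + 1) * (2⁻¹ : ℝ) ^ (T + 1)) := by
        rw [ENNReal.ofReal_mul (by positivity), show ((T : ℝ) + 1) = ((T + 1 : ℕ) : ℝ) by push_cast; ring,
          ENNReal.ofReal_natCast, ENNReal.ofReal_pow (by norm_num : (0 : ℝ) ≤ 2⁻¹),
          ENNReal.ofReal_inv_of_pos two_pos, ENNReal.ofReal_ofNat]
    _ ≤ ENNReal.ofReal y := ENNReal.ofReal_le_ofReal (hT₀ T hTT₀)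

end Summit.AtomisticToContinuum.HydrodynamicLimit.Theorems.OddContactSymmetryKineticSlab

end
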